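import Summits.RiemannHypothesis.RiemannHypothesis.Theses.ShiftedResolvent
import Literature.NumberTheory.LFunctions.WeilResolventVector
import Literature.NumberTheory.LFunctions.WeilWindowSuzukiProofs
import Literature.NumberTheory.LFunctions.WeilGroundStateRealZerosProofs
import Literature.NumberTheory.LFunctions.WeilGroundEnergyProofs
import Literature.NumberTheory.LFunctions.WeilMarkovQuadratic
import Literature.NumberTheory.LFunctions.AdversarialWeilPositivity

/-!
# RiemannHypothesis / ShiftedResolvent — REFUTATION of the support item `ResolventVectorExists` AS TYPED
(stmt-RiemannHypothesis-15970) [refuted-misstated: notation-precedence slip]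

Same defect as `ShiftedResolventResolventRealZerosRefutation.lean`: the decl inlines the Dirichlet
functional as `(weilQuadratic h).re - lam * ∫ t, ‖h t‖ ^ 2 - 2 * (weilMellin h (1 / 2)).re` WITHOUT
parentheses, and Mathlib's `∫ x, r` (body precedence 60 < `-` 65) puts the linear term INSIDE the
integral (`Literature.NumberTheory.LFunctions.weilResolventFunctional_ne_parse` records the trap; the
Literature predicate `IsWeilResolventVector` is parenthesised, the route decl is not).

**Witness.** `0 < a ≤ a₁` with `0 < ε(a)` (`exists_weilGroundEnergy_pos`, unconditional) and the
admissible shift `lam = 0`.  Then the typed functional is `J(h) = Re Q(h) ≥ ε(a)·∫‖h‖²`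
(`ConnesVanSuijlekom.weilGroundEnergy_mul_le_re`), `J(0) = 0`, so for ANY typed resolvent vector `v`
with minimising sequence `g_n`: `m ≤ 0 ≤ m`, `ε(a)∫‖g_n‖² ≤ Re Q(g_n) → 0`, hence `g_n → 0` and `v = 0`
in `L²`, i.e. `v = 0` a.e., so `weilMellin v (1/2) = ∫ v = 0` — contradicting the decl's clause
`0 < Re (weilMellin v (1/2))`.  Hence the decl is FALSE as typed (at every small window, every
admissible shift `lam = 0`).

**Class / repair.** misstated (parse slip, not mathematics).  `C′` = the same decl with
`lam * (∫ t, ‖h t‖ ^ 2)` parenthesised in BOTH occurrences, equivalently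
`∃ v, Literature.NumberTheory.LFunctions.IsWeilResolventVector a lam v ∧ (∀ t, (v t).im = 0 ∧ v (-t) = v t)
∧ 0 < (weilMellin v (1/2)).re`; the argument above does not touch `C′` (with the linear term outside
the integral `J(c·g) = c² Re Q(g) − 2c Re ĝ(1/2) < 0` for a window test `g` with `Re ĝ(1/2) > 0` and
small `c > 0`, so minimisers are not `0`).  RH is untouched: nothing here bears on the truth of RH.
-/

set_option linter.dupNamespace false

namespace Summit.RiemannHypothesis.RiemannHypothesis.Theorems

open MeasureTheory Filter Topology Set
open Literature.NumberTheory.LFunctions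

/-- refuted-misstated: `ShiftedResolvent.ResolventVectorExists` is FALSE AS TYPED — with the
unparenthesised `∫` the inline functional at the admissible shift `lam = 0 < ε(a)` (`0 < a ≤ a₁`,
`exists_weilGroundEnergy_pos`) is `Re Q(h) ≥ ε(a)∫‖h‖²` (`weilGroundEnergy_mul_le_re`) with `J(0) = 0`,
so every typed resolvent vector is the `L²`-limit of a sequence with `∫‖g_n‖² → 0`, i.e. `v = 0` a.e.,
whence `weilMellin v (1/2) = 0`, contradicting `0 < Re (weilMellin v (1/2))`.  Witness `(a, lam) =
(a₁, 0)`.  Repaired `C′`: parenthesise `lam * (∫ t, ‖h t‖ ^ 2)` (both occurrences) / use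
`IsWeilResolventVector a lam v`; the argument misses `C′`. [folklore] -/
theorem not_ResolventVectorExists :
    ¬ _root_.Summit.RiemannHypothesis.RiemannHypothesis.Theses.ShiftedResolvent.ResolventVectorExists := by
  intro H
  obtain ⟨a₁, ha₁, hpos⟩ := exists_weilGroundEnergy_pos
  have hε : 0 < weilGroundEnergy a₁ := hpos a₁ ha₁ le_rfl
  obtain ⟨v, ⟨hv2, g, hg, ⟨m, hlb, hlim⟩, hL2⟩, -, hre⟩ := H a₁ ha₁ 0 hε
  simp only [zero_mul, sub_zero] at hlb hlim
  -- `m ≤ J(0) = 0`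
  have hm0 : m ≤ 0 := by
    have h0 := hlb 0 isWeilTest_zero (by simp)
    simpa [weilQuadratic_zero] using h0
  -- the lower bound `ε(a) · ∫‖g_n‖² ≤ Re Q(g_n)`
  set N : ℕ → ℝ := fun n ↦ ∫ t, ‖g n t‖ ^ 2 with hN
  have hNnn : ∀ n, 0 ≤ N n := fun n ↦ integral_nonneg fun _ ↦ by positivity
  have hεN : ∀ n, weilGroundEnergy a₁ * N n ≤ (weilQuadratic (g n)).re :=
    fun n ↦ ConnesVanSuijlekom.weilGroundEnergy_mul_le_re (hg n).1 (hg n).2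
  -- `0 ≤ m`, hence `m = 0`, hence `∫‖g_n‖² → 0`
  have hmge : 0 ≤ m := ge_of_tendsto' hlim fun n ↦ (mul_nonneg hε.le (hNnn n)).trans (hεN n)
  have hm : m = 0 := le_antisymm hm0 hmge
  have hNlim : Tendsto N atTop (𝓝 0) := by
    have hup : Tendsto (fun n ↦ (weilQuadratic (g n)).re / weilGroundEnergy a₁) atTop (𝓝 0) := by
      simpa [hm] using hlim.div_const (weilGroundEnergy a₁)
    refine tendsto_of_tendsto_of_tendsto_of_le_of_le tendsto_const_nhds hup hNnn fun n ↦ ?_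
    rw [le_div_iff₀ hε, mul_comm]
    exact hεN n
  -- `∫‖v‖² ≤ 2∫‖g_n − v‖² + 2∫‖g_n‖²` for every `n`
  have hv_int : Integrable (fun t ↦ ‖v t‖ ^ 2) := (memLp_two_iff_integrable_sq_norm hv2.1).1 hv2
  have hgv2 : ∀ n, MemLp (fun t ↦ g n t - v t) 2 := fun n ↦ ((hg n).1.memLp_two).sub hv2
  have hgv_int : ∀ n, Integrable (fun t ↦ ‖g n t - v t‖ ^ 2) := fun n ↦
    (memLp_two_iff_integrable_sq_norm (hgv2 n).1).1 (hgv2 n)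
  have hbound : ∀ n, ∫ t, ‖v t‖ ^ 2 ≤ 2 * (∫ t, ‖g n t - v t‖ ^ 2) + 2 * N n := by
    intro n
    have hpt : ∀ t, ‖v t‖ ^ 2 ≤ 2 * ‖g n t - v t‖ ^ 2 + 2 * ‖g n t‖ ^ 2 := by
      intro t
      have h1 : ‖v t‖ ≤ ‖g n t - v t‖ + ‖g n t‖ := by
        calc ‖v t‖ = ‖g n t - (g n t - v t)‖ := by simp
          _ ≤ ‖g n t‖ + ‖g n t - v t‖ := norm_sub_le _ _
          _ = ‖g n t - v t‖ + ‖g n t‖ := add_comm _ _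
      have h2 : ‖v t‖ ^ 2 ≤ (‖g n t - v t‖ + ‖g n t‖) ^ 2 := pow_le_pow_left₀ (norm_nonneg _) h1 2
      nlinarith [h2, sq_nonneg (‖g n t - v t‖ - ‖g n t‖)]
    have hrhs : Integrable (fun t ↦ 2 * ‖g n t - v t‖ ^ 2 + 2 * ‖g n t‖ ^ 2) :=
      ((hgv_int n).const_mul 2).add (((hg n).1.integrable_norm_sq).const_mul 2)
    calc ∫ t, ‖v t‖ ^ 2 ≤ ∫ t, (2 * ‖g n t - v t‖ ^ 2 + 2 * ‖g n t‖ ^ 2) :=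
          integral_mono hv_int hrhs hpt
      _ = 2 * (∫ t, ‖g n t - v t‖ ^ 2) + 2 * N n := by
          rw [integral_add ((hgv_int n).const_mul 2) (((hg n).1.integrable_norm_sq).const_mul 2),
            integral_const_mul, integral_const_mul]
  -- hence `∫‖v‖² = 0`, i.e. `v = 0` a.e.
  have hlim2 : Tendsto (fun n ↦ 2 * (∫ t, ‖g n t - v t‖ ^ 2) + 2 * N n) atTop (𝓝 0) := by
    simpa using (hL2.const_mul 2).add (hNlim.const_mul 2)
  have hv0 : ∫ t, ‖v t‖ ^ 2 ≤ 0 := ge_of_tendsto' hlim2 hbound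
  have hvint0 : ∫ t, ‖v t‖ ^ 2 = 0 := le_antisymm hv0 (integral_nonneg fun _ ↦ by positivity)
  have hvae : (fun t ↦ ‖v t‖ ^ 2) =ᵐ[volume] 0 :=
    (integral_eq_zero_iff_of_nonneg (fun _ ↦ by positivity) hv_int).1 hvint0
  have hvae' : ∀ᵐ t : ℝ, v t = 0 := by
    filter_upwards [hvae] with t ht
    simpa using ht
  -- so `weilMellin v (1/2) = ∫ v · 1 = 0`, contradicting `0 < Re (weilMellin v (1/2))`
  have hM : weilMellin v (1 / 2) = 0 := by
    unfold weilMellin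
    exact integral_eq_zero_of_ae (by filter_upwards [hvae'] with t ht; simp [ht])
  rw [hM] at hre
  simp at hre

end Summit.RiemannHypothesis.RiemannHypothesis.Theorems
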